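import Summits.BirchSwinnertonDyer.BirchSwinnertonDyer.Theorems.ByReductionTypeAtTwoSupersingularColemanRoadLine
import Summits.BirchSwinnertonDyer.Rank1Residual.X5.TwoAdicTargets
import Literature.NumberTheory.EllipticCurves.KatoFineSelmerDualTorsion
import HarnessLib

/-!
# Route `ByReductionTypeAtTwo` (rung K4), crux `SupersingularRankZeroAtTwo` (item
# stmt-BirchSwinnertonDyer-19097), line `signed_halves_two`: THE COLEMAN ROAD, v5 — stub (4) RESHAPED TO
# PRINT SCOPE field by field (audit sheet «ssCK@2», HOME/audit/D-AUDIT-ssCK-…-at-2.md @974c2b53f8de2a72: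
# scope flag φ1, remark R-1) and to the NEW tree fact `Kato2004_fineSelmerDual_isTorsion`
# (seat `bsd-2adic-ss-1`, GEN 8)

HONEST FRAMING (cell `bsd-2adic`, run/shared/lean/pub/bsd-2adic/, HUMAN RULINGS D-0036/D-0059/D-0074):
THEOREMS ONLY; every research input an explicit hypothesis; no definition, no named fact, no instance,
no `sorry`; nothing booked; BSD is NOT proved by any of this. PARTITION (D-0054): X5@2 good-supersingular,
`a₂ = 0` sub-row (B1·O1; 208 rank-`0` classes = 206 with `ρ_{E,2^∞}` onto + 2 without: 107217l,
184041bk — seat census, evidence on the item) × `p = 2` — types-the-object-of; closes none. Companion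
of `…SupersingularColemanRoad.lean` (p482717), `…ColemanRoadLine.lean` (p483493; v4 slot (4)
`stub_zeroColemanKato` = ONE ∀-closed package F1–F4) and `…ColemanInstance16173a.lean` (p484590).

## Why v5 (the audit's Table A, row by row, and what changed in the tree since v4)

v4's package quantified over the whole `a₂ = 0` rank-`0` sub-row: F1 ((7.21): exactness at
`P = im Col⁺` and at `X⁺`), F2 (`X⁰(E/ℚ_∞)` torsion), F3 (`G ∈ Col⁺(loc Z)`, `ι G = ϖ·ι L♭` EXACTLY,
`Z ≤ 𝐇¹` integral), F4 (`length_𝔭 X⁰ ≤ length_𝔭 𝐇¹/Z` at EVERY height-one `𝔭`, NO image guard). Read at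
`p = 2` (sheet §0 (ii)–(iv)):
* F2 is PRINT-inferred at every `p` (Kato Thm. 12.4 (1) ∘ (17.13.1); «exact up to ×2 at `p = 2`» does
  not affect torsion) and is now the ACCEPTED named fact `Kato2004_fineSelmerDual_isTorsion` (file
  `KatoFineSelmerDualTorsion`, any `E/ℚ`, any `p`, naming this road as a consumer) ⇒ v5 DROPS F2 from
  the package (PUB slot).
* F3a/F3b (a `Λ`-linear Coleman functional with the zeta image in `P ≤ Λ`; which function, which
  period) are PRINT / DICTIONARY at `2` (Sprung, JNT 132 (2012) §§2–6, Def. 6.1 «if `p = 2` …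
  `Col_ℚ : H¹_Iw(T) ⊗ ℚ → (Λ ⊕ Λ) ⊗ ℚ`»; the tree's `c♭ = −a₂² + 2a₂ + 1` = Sprung's printed `p = 2`
  table entry); F3c = INTEGRALITY (`G = ϖ·L♭` with no power of `2`) is NOT in print at `2`: Kato's
  §13.14 gives `Z(f,T)_𝔭 ⊂ 𝐇¹_𝔭` at every height-one `𝔭` (Thm. 12.6, parity-free), the last step
  «`𝐇¹` free (12.4 (3), `p ≠ 2`)» being unprinted ⇒ print at `2` yields `G = 2^m·ϖ·L♭ ∈ Col⁺(loc Z)` for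
  SOME `m` (R-1). v5's F3b reads `ι G = 2^m·ϖ·ι L♭`.
* F4 at the height-one `𝔭 ∌ 2` is PRINT (Kato Thm. 12.5 (3): no image hypothesis, no parity); F4 at
  `𝔭 = (2)` is printed ONLY under (12.5.2) (Kobayashi Thm. 4.1 / 5.2 v); Sprung Thm. 7.16/7.18 «`ρ`
  surjective») and «`p ≠ 2`», its one printed warrant at `2` being Kurihara–Otsuki, PAMQ 2 (2006) p. 564
  «the proofs of Theorem 12.4 (3) and Theorem 12.5 (4) can be applied to our case even for `p = 2`
  because we are working on the cyclotomic `ℤ₂`-extension». The v4 LINE binder carried F4 at `(2)` for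
  all 208 classes WITHOUT the guard (flag φ1). v5: F4rat (every height-one `𝔭 ∌ 2`, unguarded) + ONE
  guarded clause `TwoAdicSurjective W → (m = 0 ∧ F4 at the height-one 𝔭 ∋ 2)` = Kurihara–Otsuki's
  sentence under (12.5.2); the two non-surjective classes go to a SEPARATE seventh stub (the same
  Kato-side signed divisibility there: conjecture-grade even at odd `p`; nearest road §3).
* F1 ((7.21) at `2` for Kobayashi's trace condition over `ℚ_∞`) stays the one memo-grade field (cell
  memo (LAG); unprinted: `ker Col⁺ ⟂ E⁺` at `2` and the `Δ = {±1}` descent of Sprung's `Col` to `ℚ_∞`).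
After v5, slot (4) exceeds print at `2` by exactly F1 (memo) and the guarded clause (printed
assertion, 206 classes). §1 per curve (surjective image) + «v5 is WEAKER than v4»; §2 the registered
v3 signature of `stub_zeroSignedUpper` and the crux BY NAME from the seven v5 stubs; §3 the residue of
the 2 classes (rational fields + `μ(X⁺) = 0` + `2`-integrality of `ϖ·L♭` ⇒ stub (4), no image input).

References: [Kobayashi2003] Thm. 4.1, 5.2, 6.2, 6.3, Prop. 7.1, Cor. 7.2, Thm. 7.3; [Kato2004Asterisque]
Thm. 12.4–12.6, §13.14, (14.9.3), (17.13.1); [Sprung2012] §§2–6, Def. 6.1; [KuriharaOtsuki2006] pp. 557,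
564; [DokchitserDokchitserMathZ2012] Theorem; [BDKim2013] Cor. 3.15; [Miller2011LMS] Def. 1.1.
-/

set_option autoImplicit false
-- the Theorems namespace of this sub repeats the summit name by design (D-0017 nested layout)
set_option linter.dupNamespace false

noncomputable section

open scoped Classical MatrixGroups ModularForm
open CongruenceSubgroup WeierstrassCurve Literature.NumberTheory.EllipticCurves
  Literature.NumberTheory.EllipticCurves.ModularForms Literature.NumberTheory.EllipticCurves.Sprung2017
  Literature.NumberTheory.EllipticCurves.Rank1Residual Literature.NumberTheory.EllipticCurves.Rank1Residual.Typed
  Literature.NumberTheory.EllipticCurves.Kobayashi2003 Literature.NumberTheory.EllipticCurves.IwasawaDual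
  ZpExtension Summit.BirchSwinnertonDyer.Rank1Residual Summit.BirchSwinnertonDyer.Rank1Residual.Supersingular
  Summit.BirchSwinnertonDyer.Rank1Residual.X5.O1

namespace Summit.BirchSwinnertonDyer.BirchSwinnertonDyer.Theorems
namespace SSColemanRoad

/-! ## §1 Per curve: stub (4) at `W` from the v5 package (surjective `2`-adic image) -/

section PerCurve

variable {W : WeierstrassCurve ℚ} [W.IsElliptic]

/-- **Stub (4) AT THE CURVE from the v5 (print-scoped) Coleman–Kato package**, `2`-adically SURJECTIVE
case. Inputs: `Kato2004.thm12_4` (12.4 (2), PRINT any `p`), `Kato2004_fineSelmerDual_isTorsion` (12.4 (1)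
∘ (17.13.1), PRINT any `p`), `hsurj : TwoAdicSurjective W` ((12.5.2); Dokchitser–Dokchitser certificates
per class) and the v5 package at `W`: for every cyclotomic datum, newform, period ratio `ϖ`, Pollack pair
at `2` and dual datum `D` of `Sel⁺(E/ℚ_∞)` there are `I, Y`, `P ≤ Λ`, `loc, toX, δ`, `Z ≤ 𝐇¹`, `G`, `m`
with F1 `Exact loc toX ∧ Exact toX δ` [(7.21)@2, memo], F3a `G ∈ map (P.subtype ∘ loc) Z` [Sprung
Def. 6.1 at 2], F3b `ι G = 2^m·ϖ·ι L♭` [Kato 12.6 + §13.14, dictionary at 2], F4rat at every height-one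
`𝔭 ∌ 2` [Kato 12.5 (3)], and the GUARDED clause `TwoAdicSurjective W → (m = 0 ∧ F4 at the 𝔭 ∋ 2)`
[Kurihara–Otsuki p. 564 «12.4 (3) and 12.5 (4) … even for p = 2»]. Output: `char X⁺ = (g)`, `ι(g·h) = ϖ·ι L♭`.
[cite: Kobayashi2003, Thm. 4.1 (p. 8), Thm. 6.3 (p. 11), Thm. 7.3 (p. 13)]
[cite: Kato2004Asterisque, Thm. 12.4 (1)(2) (p. 221), Thm. 12.5 (3)(4) (p. 222), Thm. 12.6 and §13.14]
[cite: KuriharaOtsuki2006, p. 564] [cite: Sprung2012, Def. 6.1] -/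
theorem signedUpperDivisibility_two_of_colemanKatoV5 (h124 : Kato2004.thm12_4)
    (hX0 : Kato2004_fineSelmerDual_isTorsion) (hsurj : TwoAdicSurjective W)
    (hCK : ∀ (κ : ZpExtension ℚ 2) (γ : Field.absoluteGaloisGroup ℚ),
      κ.IsCyclotomic → κ.IsTopGenerator γ → IsCyclotomicVariable 2 γ →
      ∀ [NeZero (W.conductorNorm ℤ)] (f : CuspForm (Gamma0 (W.conductorNorm ℤ)) 2),
        IsNewformOf W f → ∀ (ϖ : ℚ), (ϖ : ℝ) * W.realPeriodRat = plusPeriod f →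
      ∀ (Lplus Lminus : IwasawaAlgebra 2), IsPollackPair f 2 Lplus Lminus →
      ∀ (D : SignedSelmerDualData W κ γ 1) [ContinuousSMul ℤ_[2] (W.tateModule 2)],
        ∃ (I : Kato2004.IwasawaH1Data W 2 κ γ) (Y : W.FineSelmerDualData κ γ)
          (P : Submodule (IwasawaAlgebra 2) (IwasawaAlgebra 2))
          (loc : I.H →ₗ[IwasawaAlgebra 2] P) (toX : P →ₗ[IwasawaAlgebra 2] D.X)
          (δ : D.X →ₗ[IwasawaAlgebra 2] Y.X) (Z : Submodule (IwasawaAlgebra 2) I.H)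
          (G : IwasawaAlgebra 2) (m : ℕ),
          Function.Exact loc toX ∧ Function.Exact toX δ ∧
          G ∈ Submodule.map (P.subtype ∘ₗ loc) Z ∧
          iwasawaToPowerSeries 2 G =
            PowerSeries.C ((2 : ℚ_[2]) ^ m * (ϖ : ℚ_[2])) *
              iwasawaToPowerSeries 2 (kobayashiL 1 Lplus Lminus) ∧
          (∀ 𝔭 : PrimeSpectrum (IwasawaAlgebra 2), 𝔭.asIdeal.height = 1 →
            PowerSeries.C (2 : ℤ_[2]) ∉ 𝔭.asIdeal →
            Literature.NumberTheory.EllipticCurves.Module.lengthAt (IwasawaAlgebra 2) Y.X 𝔭 ≤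
              Literature.NumberTheory.EllipticCurves.Module.lengthAt (IwasawaAlgebra 2) (I.H ⧸ Z) 𝔭) ∧
          (TwoAdicSurjective W → m = 0 ∧
            ∀ 𝔭 : PrimeSpectrum (IwasawaAlgebra 2), 𝔭.asIdeal.height = 1 →
              PowerSeries.C (2 : ℤ_[2]) ∈ 𝔭.asIdeal →
              Literature.NumberTheory.EllipticCurves.Module.lengthAt (IwasawaAlgebra 2) Y.X 𝔭 ≤
                Literature.NumberTheory.EllipticCurves.Module.lengthAt (IwasawaAlgebra 2) (I.H ⧸ Z) 𝔭)) :
    ∀ (κ : ZpExtension ℚ 2) (γ : Field.absoluteGaloisGroup ℚ),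
      κ.IsCyclotomic → κ.IsTopGenerator γ → IsCyclotomicVariable 2 γ →
      ∀ [NeZero (W.conductorNorm ℤ)] (f : CuspForm (Gamma0 (W.conductorNorm ℤ)) 2),
        IsNewformOf W f → ∀ (ϖ : ℚ), (ϖ : ℝ) * W.realPeriodRat = plusPeriod f →
      ∀ (Lplus Lminus : IwasawaAlgebra 2), IsPollackPair f 2 Lplus Lminus →
      ∀ (D : SignedSelmerDualData W κ γ 1),
        ∃ g h : IwasawaAlgebra 2, D.charIdeal = Ideal.span {g} ∧
          iwasawaToPowerSeries 2 (g * h) =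
            PowerSeries.C (ϖ : ℚ_[2]) * iwasawaToPowerSeries 2 (kobayashiL 1 Lplus Lminus) := by
  intro κ γ hκ hγ hγ' _ f hf ϖ hϖ Lplus Lminus hPP D
  haveI : ContinuousSMul ℤ_[2] (W.tateModule 2) := TateModule.continuousSMul_padicInt
  obtain ⟨I, Y, P, loc, toX, δ, Z, G, m, hPX, hXY, hGZ, hιG, hESrat, hguard⟩ :=
    hCK κ γ hκ hγ hγ' f hf ϖ hϖ Lplus Lminus hPP D
  obtain ⟨hm, hES2⟩ := hguard hsurj
  subst hm
  have hιG' : iwasawaToPowerSeries 2 G =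
      PowerSeries.C (ϖ : ℚ_[2]) * iwasawaToPowerSeries 2 (kobayashiL 1 Lplus Lminus) := by
    rw [hιG, pow_zero, one_mul]
  have hES : ∀ 𝔭 : PrimeSpectrum (IwasawaAlgebra 2), 𝔭.asIdeal.height = 1 →
      Literature.NumberTheory.EllipticCurves.Module.lengthAt (IwasawaAlgebra 2) Y.X 𝔭 ≤
        Literature.NumberTheory.EllipticCurves.Module.lengthAt (IwasawaAlgebra 2) (I.H ⧸ Z) 𝔭 := by
    intro 𝔭 h1
    by_cases h2 : PowerSeries.C (2 : ℤ_[2]) ∈ 𝔭.asIdeal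
    · exact hES2 𝔭 h1 h2
    · exact hESrat 𝔭 h1 h2
  have hY : Module.IsTorsion (IwasawaAlgebra 2) Y.X := hX0 W 2 κ γ hκ hγ Y
  obtain ⟨htf, hrank⟩ := h124.isTorsionFree_and_rank_le_one W 2 hκ hγ I
  haveI := htf
  exact signedUpperShape_two_of_colemanSkeleton hγ I hrank Y D loc P.subtype P.injective_subtype toX δ
    hPX hXY hY Z hGZ hES hιG'

/-- **v5 is WEAKER than v4 (the reshape strengthens nothing).** The v4 package at the datum yields the
v5 package at the datum with `m = 0` and the guarded clause discharged outright.
[cite: Kobayashi2003, Thm. 4.1 (p. 8) and §7] [cite: Kato2004Asterisque, Thm. 12.5 (3)(4) (p. 222)] -/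
theorem colemanKatoV5_of_colemanKato {κ : ZpExtension ℚ 2} {γ : Field.absoluteGaloisGroup ℚ}
    [ContinuousSMul ℤ_[2] (W.tateModule 2)]
    {D : SignedSelmerDualData W κ γ 1} {ϖ : ℚ} {Lplus Lminus : IwasawaAlgebra 2}
    (h : ∃ (I : Kato2004.IwasawaH1Data W 2 κ γ) (Y : W.FineSelmerDualData κ γ)
          (P : Submodule (IwasawaAlgebra 2) (IwasawaAlgebra 2))
          (loc : I.H →ₗ[IwasawaAlgebra 2] P) (toX : P →ₗ[IwasawaAlgebra 2] D.X)
          (δ : D.X →ₗ[IwasawaAlgebra 2] Y.X) (Z : Submodule (IwasawaAlgebra 2) I.H)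
          (G : IwasawaAlgebra 2),
          Function.Exact loc toX ∧ Function.Exact toX δ ∧
          Module.IsTorsion (IwasawaAlgebra 2) Y.X ∧
          G ∈ Submodule.map (P.subtype ∘ₗ loc) Z ∧
          iwasawaToPowerSeries 2 G =
            PowerSeries.C (ϖ : ℚ_[2]) * iwasawaToPowerSeries 2 (kobayashiL 1 Lplus Lminus) ∧
          ∀ 𝔭 : PrimeSpectrum (IwasawaAlgebra 2), 𝔭.asIdeal.height = 1 →
            Literature.NumberTheory.EllipticCurves.Module.lengthAt (IwasawaAlgebra 2) Y.X 𝔭 ≤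
              Literature.NumberTheory.EllipticCurves.Module.lengthAt (IwasawaAlgebra 2) (I.H ⧸ Z) 𝔭) :
    ∃ (I : Kato2004.IwasawaH1Data W 2 κ γ) (Y : W.FineSelmerDualData κ γ)
      (P : Submodule (IwasawaAlgebra 2) (IwasawaAlgebra 2))
      (loc : I.H →ₗ[IwasawaAlgebra 2] P) (toX : P →ₗ[IwasawaAlgebra 2] D.X)
      (δ : D.X →ₗ[IwasawaAlgebra 2] Y.X) (Z : Submodule (IwasawaAlgebra 2) I.H)
      (G : IwasawaAlgebra 2) (m : ℕ),
      Function.Exact loc toX ∧ Function.Exact toX δ ∧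
      G ∈ Submodule.map (P.subtype ∘ₗ loc) Z ∧
      iwasawaToPowerSeries 2 G =
        PowerSeries.C ((2 : ℚ_[2]) ^ m * (ϖ : ℚ_[2])) *
          iwasawaToPowerSeries 2 (kobayashiL 1 Lplus Lminus) ∧
      (∀ 𝔭 : PrimeSpectrum (IwasawaAlgebra 2), 𝔭.asIdeal.height = 1 →
        PowerSeries.C (2 : ℤ_[2]) ∉ 𝔭.asIdeal →
        Literature.NumberTheory.EllipticCurves.Module.lengthAt (IwasawaAlgebra 2) Y.X 𝔭 ≤
          Literature.NumberTheory.EllipticCurves.Module.lengthAt (IwasawaAlgebra 2) (I.H ⧸ Z) 𝔭) ∧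
      (TwoAdicSurjective W → m = 0 ∧
        ∀ 𝔭 : PrimeSpectrum (IwasawaAlgebra 2), 𝔭.asIdeal.height = 1 →
          PowerSeries.C (2 : ℤ_[2]) ∈ 𝔭.asIdeal →
          Literature.NumberTheory.EllipticCurves.Module.lengthAt (IwasawaAlgebra 2) Y.X 𝔭 ≤
            Literature.NumberTheory.EllipticCurves.Module.lengthAt (IwasawaAlgebra 2) (I.H ⧸ Z) 𝔭) := by
  obtain ⟨I, Y, P, loc, toX, δ, Z, G, hPX, hXY, -, hGZ, hιG, hES⟩ := h
  refine ⟨I, Y, P, loc, toX, δ, Z, G, 0, hPX, hXY, hGZ, ?_, fun 𝔭 h1 _ ↦ hES 𝔭 h1,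
    fun _ ↦ ⟨rfl, fun 𝔭 h1 _ ↦ hES 𝔭 h1⟩⟩
  rw [hιG, pow_zero, one_mul]

end PerCurve

/-! ## §2 ∀-closed: the registered v3 signature of `stub_zeroSignedUpper` and the crux by name (v5) -/

/-- **`stub_zeroSignedUpper` (v3) — its REGISTERED SIGNATURE VERBATIM — from the two Kato facts
(PRINT, any `p`), the ∀-closed v5 package `hCK` on the `a₂ = 0` rank-`0` sub-row and the seventh stub
`hNS` (the same conclusion on the 2 `2`-adically NON-surjective classes, where no printed road exists even
at odd `p`)**, by cases on `TwoAdicSurjective W`. [cite: Kobayashi2003, Thm. 4.1 (p. 8) and §7 (pp. 12–13)]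
[cite: Kato2004Asterisque, Thm. 12.4–12.6 (pp. 221–222)] [cite: KuriharaOtsuki2006, p. 564] -/
theorem zeroSignedUpper_of_colemanKatoV5AtTwo (h124 : Kato2004.thm12_4)
    (hX0 : Kato2004_fineSelmerDual_isTorsion)
    (hCK : ∀ (W : WeierstrassCurve ℚ) [W.IsElliptic] [W.IsGloballyMinimal],
      ¬ W.HasCM → W.analyticRank = 0 → GoodSS W 2 → W.frobeniusTrace 2 = 0 →
      ∀ (κ : ZpExtension ℚ 2) (γ : Field.absoluteGaloisGroup ℚ),
        κ.IsCyclotomic → κ.IsTopGenerator γ → IsCyclotomicVariable 2 γ →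
        ∀ [NeZero (W.conductorNorm ℤ)] (f : CuspForm (Gamma0 (W.conductorNorm ℤ)) 2),
          IsNewformOf W f → ∀ (ϖ : ℚ), (ϖ : ℝ) * W.realPeriodRat = plusPeriod f →
        ∀ (Lplus Lminus : IwasawaAlgebra 2), IsPollackPair f 2 Lplus Lminus →
        ∀ (D : SignedSelmerDualData W κ γ 1) [ContinuousSMul ℤ_[2] (W.tateModule 2)],
          ∃ (I : Kato2004.IwasawaH1Data W 2 κ γ) (Y : W.FineSelmerDualData κ γ)
            (P : Submodule (IwasawaAlgebra 2) (IwasawaAlgebra 2))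
            (loc : I.H →ₗ[IwasawaAlgebra 2] P) (toX : P →ₗ[IwasawaAlgebra 2] D.X)
            (δ : D.X →ₗ[IwasawaAlgebra 2] Y.X) (Z : Submodule (IwasawaAlgebra 2) I.H)
            (G : IwasawaAlgebra 2) (m : ℕ),
            Function.Exact loc toX ∧ Function.Exact toX δ ∧
            G ∈ Submodule.map (P.subtype ∘ₗ loc) Z ∧
            iwasawaToPowerSeries 2 G =
              PowerSeries.C ((2 : ℚ_[2]) ^ m * (ϖ : ℚ_[2])) *
                iwasawaToPowerSeries 2 (kobayashiL 1 Lplus Lminus) ∧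
            (∀ 𝔭 : PrimeSpectrum (IwasawaAlgebra 2), 𝔭.asIdeal.height = 1 →
              PowerSeries.C (2 : ℤ_[2]) ∉ 𝔭.asIdeal →
              Literature.NumberTheory.EllipticCurves.Module.lengthAt (IwasawaAlgebra 2) Y.X 𝔭 ≤
                Literature.NumberTheory.EllipticCurves.Module.lengthAt (IwasawaAlgebra 2) (I.H ⧸ Z) 𝔭) ∧
            (TwoAdicSurjective W → m = 0 ∧
              ∀ 𝔭 : PrimeSpectrum (IwasawaAlgebra 2), 𝔭.asIdeal.height = 1 →
                PowerSeries.C (2 : ℤ_[2]) ∈ 𝔭.asIdeal →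
                Literature.NumberTheory.EllipticCurves.Module.lengthAt (IwasawaAlgebra 2) Y.X 𝔭 ≤
                  Literature.NumberTheory.EllipticCurves.Module.lengthAt (IwasawaAlgebra 2) (I.H ⧸ Z) 𝔭))
    (hNS : ∀ (W : WeierstrassCurve ℚ) [W.IsElliptic] [W.IsGloballyMinimal],
      ¬ W.HasCM → W.analyticRank = 0 → GoodSS W 2 → W.frobeniusTrace 2 = 0 →
      ¬ TwoAdicSurjective W →
      ∀ (κ : ZpExtension ℚ 2) (γ : Field.absoluteGaloisGroup ℚ),
        κ.IsCyclotomic → κ.IsTopGenerator γ → IsCyclotomicVariable 2 γ →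
        ∀ [NeZero (W.conductorNorm ℤ)] (f : CuspForm (Gamma0 (W.conductorNorm ℤ)) 2),
          IsNewformOf W f → ∀ (ϖ : ℚ), (ϖ : ℝ) * W.realPeriodRat = plusPeriod f →
        ∀ (Lplus Lminus : IwasawaAlgebra 2), IsPollackPair f 2 Lplus Lminus →
        ∀ (D : SignedSelmerDualData W κ γ 1),
          ∃ g h : IwasawaAlgebra 2, D.charIdeal = Ideal.span {g} ∧
            iwasawaToPowerSeries 2 (g * h) =
              PowerSeries.C (ϖ : ℚ_[2]) * iwasawaToPowerSeries 2 (kobayashiL 1 Lplus Lminus)) :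
    ∀ (W : WeierstrassCurve ℚ) [W.IsElliptic] [W.IsGloballyMinimal],
      ¬ W.HasCM → W.analyticRank = 0 → GoodSS W 2 → W.frobeniusTrace 2 = 0 →
      ∀ (κ : ZpExtension ℚ 2) (γ : Field.absoluteGaloisGroup ℚ),
        κ.IsCyclotomic → κ.IsTopGenerator γ → IsCyclotomicVariable 2 γ →
        ∀ [NeZero (W.conductorNorm ℤ)] (f : CuspForm (Gamma0 (W.conductorNorm ℤ)) 2),
          IsNewformOf W f → ∀ (ϖ : ℚ), (ϖ : ℝ) * W.realPeriodRat = plusPeriod f →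
        ∀ (Lplus Lminus : IwasawaAlgebra 2), IsPollackPair f 2 Lplus Lminus →
        ∀ (D : SignedSelmerDualData W κ γ 1),
          ∃ g h : IwasawaAlgebra 2, D.charIdeal = Ideal.span {g} ∧
            iwasawaToPowerSeries 2 (g * h) =
              PowerSeries.C (ϖ : ℚ_[2]) * iwasawaToPowerSeries 2 (kobayashiL 1 Lplus Lminus) := by
  intro W _ _ hcm hr hss ha
  by_cases hs : TwoAdicSurjective W
  · exact signedUpperDivisibility_two_of_colemanKatoV5 h124 hX0 hs (hCK W hcm hr hss ha)
  · exact hNS W hcm hr hss ha hs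

/-- **Crux `SupersingularRankZeroAtTwo` BY NAME from the seven v5 stubs of line `signed_halves_two`**
(their signatures verbatim: `hPub` = `stub_ssPub`, `hKato` = `stub_katoPub` (`Kato2004.thm12_4 ∧
Kato2004_fineSelmerDual_isTorsion`, both ACCEPTED named facts, any `p`), `hEC` = `stub_zeroSignedEulerChar`,
`hlow` = `stub_zeroKobayashiLower`, `hCK` = `stub_zeroColemanKato` (v5 package), `hNS` =
`stub_zeroNonsurjSignedUpper`, `hTwo` = `stub_traceTwoMillerHalves`) — p434732's
`supersingularRankZeroAtTwo_of_line_eulerChar` fed through `zeroSignedUpper_of_colemanKatoV5AtTwo`.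
[cite: Kobayashi2003, Thm. 1.2, Thm. 4.1, §7 and Conjecture (p. 2)] [cite: BDKim2013, Thm. 1.1 and Cor. 3.15]
[cite: Kato2004Asterisque, Thm. 12.4–12.6 (pp. 221–222)] [cite: Miller2011LMS, Def. 1.1] -/
theorem supersingularRankZeroAtTwo_of_line_colemanKatoV5
    (hPub : nonempty_modularParametrizationData ∧ rank_eq_analyticRank_of_analyticRank_le_one)
    (hKato : Kato2004.thm12_4 ∧ Kato2004_fineSelmerDual_isTorsion)
    (hEC : ∀ (W : WeierstrassCurve ℚ) [W.IsElliptic] [W.IsGloballyMinimal],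
        ¬ W.HasCM → W.analyticRank = 0 → GoodSS W 2 → W.frobeniusTrace 2 = 0 →
        ∀ (κ : ZpExtension ℚ 2) (γ : Field.absoluteGaloisGroup ℚ),
          κ.IsCyclotomic → κ.IsTopGenerator γ → Finite (W.selmerGroupPInfty 2) →
          Finite (endInvariants (conjSignedSelmerInfty W κ 1 γ - 1)) ∧
            ∃ u : ℤ_[2]ˣ, (Nat.card (endInvariants (conjSignedSelmerInfty W κ 1 γ - 1)) : ℚ_[2]) =
              ((u : ℤ_[2]) : ℚ_[2]) * ((2 : ℕ) : ℚ_[2]) ^ (padicValNat 2 W.tamagawaProduct) *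
                (Nat.card (W.selmerGroupPInfty 2) : ℚ_[2]) *
                  (Nat.card (EndCoinvariants (conjSignedSelmerInfty W κ 1 γ - 1)) : ℚ_[2]))
    (hlow : ∀ (W : WeierstrassCurve ℚ) [W.IsElliptic] [W.IsGloballyMinimal],
      ¬ W.HasCM → W.analyticRank = 0 → GoodSS W 2 → W.frobeniusTrace 2 = 0 →
        KobayashiLowerDivisibility W 2 1)
    (hCK : ∀ (W : WeierstrassCurve ℚ) [W.IsElliptic] [W.IsGloballyMinimal],
      ¬ W.HasCM → W.analyticRank = 0 → GoodSS W 2 → W.frobeniusTrace 2 = 0 →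
      ∀ (κ : ZpExtension ℚ 2) (γ : Field.absoluteGaloisGroup ℚ),
        κ.IsCyclotomic → κ.IsTopGenerator γ → IsCyclotomicVariable 2 γ →
        ∀ [NeZero (W.conductorNorm ℤ)] (f : CuspForm (Gamma0 (W.conductorNorm ℤ)) 2),
          IsNewformOf W f → ∀ (ϖ : ℚ), (ϖ : ℝ) * W.realPeriodRat = plusPeriod f →
        ∀ (Lplus Lminus : IwasawaAlgebra 2), IsPollackPair f 2 Lplus Lminus →
        ∀ (D : SignedSelmerDualData W κ γ 1) [ContinuousSMul ℤ_[2] (W.tateModule 2)],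
          ∃ (I : Kato2004.IwasawaH1Data W 2 κ γ) (Y : W.FineSelmerDualData κ γ)
            (P : Submodule (IwasawaAlgebra 2) (IwasawaAlgebra 2))
            (loc : I.H →ₗ[IwasawaAlgebra 2] P) (toX : P →ₗ[IwasawaAlgebra 2] D.X)
            (δ : D.X →ₗ[IwasawaAlgebra 2] Y.X) (Z : Submodule (IwasawaAlgebra 2) I.H)
            (G : IwasawaAlgebra 2) (m : ℕ),
            Function.Exact loc toX ∧ Function.Exact toX δ ∧
            G ∈ Submodule.map (P.subtype ∘ₗ loc) Z ∧
            iwasawaToPowerSeries 2 G =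
              PowerSeries.C ((2 : ℚ_[2]) ^ m * (ϖ : ℚ_[2])) *
                iwasawaToPowerSeries 2 (kobayashiL 1 Lplus Lminus) ∧
            (∀ 𝔭 : PrimeSpectrum (IwasawaAlgebra 2), 𝔭.asIdeal.height = 1 →
              PowerSeries.C (2 : ℤ_[2]) ∉ 𝔭.asIdeal →
              Literature.NumberTheory.EllipticCurves.Module.lengthAt (IwasawaAlgebra 2) Y.X 𝔭 ≤
                Literature.NumberTheory.EllipticCurves.Module.lengthAt (IwasawaAlgebra 2) (I.H ⧸ Z) 𝔭) ∧
            (TwoAdicSurjective W → m = 0 ∧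
              ∀ 𝔭 : PrimeSpectrum (IwasawaAlgebra 2), 𝔭.asIdeal.height = 1 →
                PowerSeries.C (2 : ℤ_[2]) ∈ 𝔭.asIdeal →
                Literature.NumberTheory.EllipticCurves.Module.lengthAt (IwasawaAlgebra 2) Y.X 𝔭 ≤
                  Literature.NumberTheory.EllipticCurves.Module.lengthAt (IwasawaAlgebra 2) (I.H ⧸ Z) 𝔭))
    (hNS : ∀ (W : WeierstrassCurve ℚ) [W.IsElliptic] [W.IsGloballyMinimal],
      ¬ W.HasCM → W.analyticRank = 0 → GoodSS W 2 → W.frobeniusTrace 2 = 0 →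
      ¬ TwoAdicSurjective W →
      ∀ (κ : ZpExtension ℚ 2) (γ : Field.absoluteGaloisGroup ℚ),
        κ.IsCyclotomic → κ.IsTopGenerator γ → IsCyclotomicVariable 2 γ →
        ∀ [NeZero (W.conductorNorm ℤ)] (f : CuspForm (Gamma0 (W.conductorNorm ℤ)) 2),
          IsNewformOf W f → ∀ (ϖ : ℚ), (ϖ : ℝ) * W.realPeriodRat = plusPeriod f →
        ∀ (Lplus Lminus : IwasawaAlgebra 2), IsPollackPair f 2 Lplus Lminus →
        ∀ (D : SignedSelmerDualData W κ γ 1),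
          ∃ g h : IwasawaAlgebra 2, D.charIdeal = Ideal.span {g} ∧
            iwasawaToPowerSeries 2 (g * h) =
              PowerSeries.C (ϖ : ℚ_[2]) * iwasawaToPowerSeries 2 (kobayashiL 1 Lplus Lminus))
    (hTwo : (∀ (W : WeierstrassCurve ℚ) [W.IsElliptic] [W.IsGloballyMinimal],
        ¬ W.HasCM → W.analyticRank = 0 → GoodSS W 2 →
          (W.frobeniusTrace 2 = 2 ∨ W.frobeniusTrace 2 = -2) → MissingLowerBoundAt W 2) ∧
      (∀ (W : WeierstrassCurve ℚ) [W.IsElliptic] [W.IsGloballyMinimal],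
        ¬ W.HasCM → W.analyticRank = 0 → GoodSS W 2 →
          (W.frobeniusTrace 2 = 2 ∨ W.frobeniusTrace 2 = -2) → MissingUpperBoundAt W 2)) :
    Summit.BirchSwinnertonDyer.BirchSwinnertonDyer.Theses.ByReductionTypeAtTwo.SupersingularRankZeroAtTwo :=
  supersingularRankZeroAtTwo_of_line_eulerChar hPub hEC hlow
    (zeroSignedUpper_of_colemanKatoV5AtTwo hKato.1 hKato.2 hCK hNS) hTwo

/-! ## §3 The residue of the two non-surjective classes, kernel-precise: the rational v5 fields + `μ(X⁺) = 0` + `2`-integrality of `ϖ·L♭` -/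

section Residue

variable {W : WeierstrassCurve ℚ} [W.IsElliptic] [ContinuousSMul ℤ_[2] (W.tateModule 2)]
  {κ : ZpExtension ℚ 2} {γ : Field.absoluteGaloisGroup ℚ}
  {P : Type*} [AddCommGroup P] [Module (IwasawaAlgebra 2) P]

/-- **Stub (4) at the datum WITHOUT any image hypothesis, from the RATIONAL v5 fields plus `μ(X⁺) = 0`
plus `2`-integrality of `ϖ·L♭`.** Data as in `exists_pow_mul_mem_charIdeal_of_colemanSkeletonRat` at
`p = 2` (Euler-system bound ONLY at the height-one `𝔭 ∌ 2` = Kato Thm. 12.5 (3)), `ι G = 2^m·ϖ·ι L♭`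
(F3b, v5), some `G₀ ∈ Λ`, `G₀ ≠ 0`, with `ι G₀ = ϖ·ι L♭` (`ϖ·L♭` is `2`-integral; `≠ 0` in rank `0`),
and `2 ∤ g` for the characteristic power series `g` of `X⁺` (`μ(X⁺) = 0`) ⇒ `g·h = G₀`: BOTH powers of
`2` (Euler-system side `2^{m'}·G ∈ char X⁺`; zeta side `G = 2^m·G₀`) cancel against `μ = 0` in the UFD
`Λ`. The exact residue of the seventh v5 stub (classes 107217l, 184041bk): `μ(X⁺) = 0` and `ϖ·L♭ ∈ Λ`.
[cite: Kobayashi2003, Thm. 4.1 first display (p. 8)] [cite: Kato2004Asterisque, Thm. 12.5 (3) (p. 222), Thm. 12.6] -/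
theorem exists_mul_eq_of_colemanSkeletonRatV5_of_mu (hγ : κ.IsTopGenerator γ)
    (I : Kato2004.IwasawaH1Data W 2 κ γ) [Module.IsTorsionFree (IwasawaAlgebra 2) I.H]
    (hrank : Module.rank (IwasawaAlgebra 2) I.H ≤ 1)
    (Y : W.FineSelmerDualData κ γ) (D : SignedSelmerDualData W κ γ 1)
    (loc : I.H →ₗ[IwasawaAlgebra 2] P) (col : P →ₗ[IwasawaAlgebra 2] IwasawaAlgebra 2)
    (hcol : Function.Injective col)
    (toX : P →ₗ[IwasawaAlgebra 2] D.X) (δ : D.X →ₗ[IwasawaAlgebra 2] Y.X)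
    (hPX : Function.Exact loc toX) (hXY : Function.Exact toX δ)
    (hY : Module.IsTorsion (IwasawaAlgebra 2) Y.X)
    (Z : Submodule (IwasawaAlgebra 2) I.H) {G : IwasawaAlgebra 2}
    (hGZ : G ∈ Submodule.map (col ∘ₗ loc) Z)
    (hES : ∀ 𝔭 : PrimeSpectrum (IwasawaAlgebra 2), 𝔭.asIdeal.height = 1 →
      PowerSeries.C (2 : ℤ_[2]) ∉ 𝔭.asIdeal →
      Literature.NumberTheory.EllipticCurves.Module.lengthAt (IwasawaAlgebra 2) Y.X 𝔭 ≤
        Literature.NumberTheory.EllipticCurves.Module.lengthAt (IwasawaAlgebra 2) (I.H ⧸ Z) 𝔭)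
    {m : ℕ} {ϖ : ℚ} {Lplus Lminus : IwasawaAlgebra 2}
    (hιG : iwasawaToPowerSeries 2 G =
      PowerSeries.C ((2 : ℚ_[2]) ^ m * (ϖ : ℚ_[2])) * iwasawaToPowerSeries 2 (kobayashiL 1 Lplus Lminus))
    {G₀ : IwasawaAlgebra 2} (hG₀ : G₀ ≠ 0)
    (hιG₀ : iwasawaToPowerSeries 2 G₀ =
      PowerSeries.C (ϖ : ℚ_[2]) * iwasawaToPowerSeries 2 (kobayashiL 1 Lplus Lminus))
    {g : IwasawaAlgebra 2} (hg : D.charIdeal = Ideal.span {g})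
    (hμ : ¬ PowerSeries.C (2 : ℤ_[2]) ∣ g) :
    ∃ h : IwasawaAlgebra 2,
      iwasawaToPowerSeries 2 (g * h) =
        PowerSeries.C (ϖ : ℚ_[2]) * iwasawaToPowerSeries 2 (kobayashiL 1 Lplus Lminus) := by
  -- `G = 2^m · G₀` in `Λ` (`ι` is injective)
  have hC2 : iwasawaToPowerSeries 2 (PowerSeries.C (2 : ℤ_[2])) = PowerSeries.C (2 : ℚ_[2]) := by
    rw [PowerSeries.map_C, map_ofNat]
  have hGG₀ : G = PowerSeries.C (2 : ℤ_[2]) ^ m * G₀ := by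
    apply iwasawaToPowerSeries_injective 2
    simp only [map_mul, map_pow, hC2, hιG₀, hιG, mul_assoc]
  have h2C : (PowerSeries.C ((2 : ℕ) : ℤ_[2]) : IwasawaAlgebra 2) = PowerSeries.C (2 : ℤ_[2]) := by
    simp
  have h2 : Prime (PowerSeries.C (2 : ℤ_[2]) : IwasawaAlgebra 2) := by
    rw [← h2C]; exact IwasawaAlgebra.prime_C 2
  have hG : G ≠ 0 := by
    rw [hGG₀]; exact mul_ne_zero (pow_ne_zero _ h2.ne_zero) hG₀
  obtain ⟨-, m', hm'⟩ := exists_pow_mul_mem_charIdeal_of_colemanSkeletonRat hγ I hrank Y D loc col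
    hcol toX δ hPX hXY hY Z hG hGZ (fun 𝔭 h1 hp𝔭 ↦ hES 𝔭 h1 (by simpa using hp𝔭))
  rw [h2C, hg, hGG₀, ← mul_assoc, ← pow_add] at hm'
  have hdvd : g ∣ PowerSeries.C (2 : ℤ_[2]) ^ (m' + m) * G₀ := Ideal.mem_span_singleton.mp hm'
  obtain ⟨h, hh⟩ := dvd_of_dvd_C_pow_mul_of_not_dvd h2 hμ hdvd
  exact ⟨h, by rw [← hh]; exact hιG₀⟩

end Residue

end SSColemanRoad
end Summit.BirchSwinnertonDyer.BirchSwinnertonDyer.Theorems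

end
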